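import Literature.NumberTheory.Automorphic.UnitIdeleArchimedeanIntegration
import Literature.NumberTheory.Automorphic.MixedSpaceUnitsHaar
import Literature.NumberTheory.GaloisRepresentations.HeckeCharacterAutConj
import Literature.NumberTheory.GaloisRepresentations.AdmissibleModulusGalois
import Literature.NumberTheory.Automorphic.AdelicGLnGlue
import HarnessLib

/-!
# Integration over the unit ideles in the full archimedean coordinates:
`∫_{𝕌_K} H(a_∞) dν(a) = c ∫_{K_∞ˣ} H d^×x`

Topic `NumberTheory/Automorphic`; namespace `Literature.NumberTheory.Automorphic`. Companion of
`UnitIdeleArchimedeanIntegration` (theorems; one definition with body, the archimedean coordinate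
`archUnitsOfIdele : 𝕀_K →* K_∞ˣ`, `K_∞ = mixedSpace K`). There the image of `ν|_{𝕌_K}` under the
LOGARITHMIC sizes `log ‖a_w‖` is identified with a multiple of Lebesgue measure; for the plumbing of
the Kirillov `L²`-bound into the Rankin–Selberg torus integral (the `n ≤ 2` case of the named fact
`JacquetShalika1981_partialPairL_pole_of_eq_conj`) the integrands depend on the full archimedean
component (angles included), and the same argument gives

  `∫_{𝕌_K} H(a_∞) dν(a) = c ∫_{K_∞ˣ} H(x) d^×x`   (`exists_setLIntegral_unitIdeles_eq_mul_lintegral_mixedUnits`)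

for every left-invariant measure `ν` on `𝕀_K` finite on compact sets, every measurable `H ≥ 0` and
`d^×x = mixedUnitsHaar K`: the image of `ν|_{𝕌_K}` under `a ↦ a_∞` is invariant under `K_∞ˣ`
(translate by the infinite ideles `(x, 1) ∈ 𝕌_K`) and finite on compacts
(`isCompact_setOf_mem_unitIdeles_norm_le`), hence a multiple of the Haar measure
(`Measure.isMulLeftInvariant_eq_smul`). (Tate (1967), §4.3.)

## References

* J. Tate, *Fourier analysis in number fields and Hecke's zeta-functions*, in Cassels–Fröhlich (1967),
  Ch. XV §4.3 [CasselsFrohlichANT1967].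
-/

noncomputable section

open MeasureTheory Measure NumberField IsDedekindDomain Set Filter Topology NumberField.InfinitePlace
open NumberField.mixedEmbedding
open Literature.NumberTheory.GaloisRepresentations (ideleGroup unitIdeles infiniteIdeles)
open Literature.NumberTheory.GaloisRepresentations.HeckeCharacter (infPart)
open scoped ENNReal NNReal Pointwise Classical

namespace Literature.NumberTheory.Automorphic

section Arch

variable (K : Type) [Field K] [NumberField K]

/-- **The archimedean coordinate** `𝕀_K →* K_∞ˣ`, `a ↦ a_∞` read in `K_∞ = mixedSpace K`. [folklore] -/
def archUnitsOfIdele : ideleGroup K →* (mixedSpace K)ˣ :=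
  (Units.map (InfiniteAdeleRing.ringEquiv_mixedSpace K).toRingHom.toMonoidHom).comp (infPart K)

variable {K}

/-- `archUnitsOfIdele a`, as an element of `K_∞`, is the image of `a_∞`. [folklore] -/
theorem coe_archUnitsOfIdele (a : ideleGroup K) :
    ((archUnitsOfIdele K a : (mixedSpace K)ˣ) : mixedSpace K) = InfiniteAdeleRing.ringEquiv_mixedSpace K ((a : AdeleRing (𝓞 K) K).1) := rfl

/-- The infinite idele `(x, 1)` attached to `x ∈ K_∞ˣ`. [folklore] -/
def infiniteIdeleOfMixed (x : (mixedSpace K)ˣ) : ideleGroup K :=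
  infiniteIdeles K (Units.map (InfiniteAdeleRing.ringEquiv_mixedSpace K).symm.toRingHom.toMonoidHom x)

/-- `(x, 1)` is a unit idele. [folklore] -/
theorem infiniteIdeleOfMixed_mem_unitIdeles (x : (mixedSpace K)ˣ) : infiniteIdeleOfMixed x ∈ unitIdeles K :=
  GaloisRepresentations.infiniteIdeles_mem_unitIdeles _

/-- The archimedean coordinate of `(x, 1)` is `x`. [folklore] -/
theorem archUnitsOfIdele_infiniteIdeleOfMixed (x : (mixedSpace K)ˣ) : archUnitsOfIdele K (infiniteIdeleOfMixed x) = x := by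
  refine Units.ext ?_
  rw [coe_archUnitsOfIdele]
  unfold infiniteIdeleOfMixed
  rw [GaloisRepresentations.infiniteIdeles_fst]
  show InfiniteAdeleRing.ringEquiv_mixedSpace K ((InfiniteAdeleRing.ringEquiv_mixedSpace K).symm (x : mixedSpace K)) = x
  exact (InfiniteAdeleRing.ringEquiv_mixedSpace K).apply_symm_apply _

/-- The archimedean coordinate is continuous. [folklore] -/
theorem continuous_archUnitsOfIdele : Continuous (archUnitsOfIdele K) := by
  have h1 : Continuous (Units.map (InfiniteAdeleRing.ringEquiv_mixedSpace K).toRingHom.toMonoidHom) :=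
    Continuous.units_map _ (continuous_ringEquiv_mixedSpace K)
  exact h1.comp GaloisRepresentations.HeckeCharacter.continuous_infPart

/-- The archimedean sizes are continuous functions of the archimedean coordinate: `‖a_w‖ = ‖(e⁻¹ (a_∞))_w‖`. [folklore] -/
theorem norm_fst_eq_of_archUnitsOfIdele (a : ideleGroup K) (w : InfinitePlace K) :
    ‖((a : ideleGroup K) : AdeleRing (𝓞 K) K).1 w‖ =
      ‖(InfiniteAdeleRing.ringEquiv_mixedSpace K).symm ((archUnitsOfIdele K a : (mixedSpace K)ˣ) : mixedSpace K) w‖ := by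
  rw [coe_archUnitsOfIdele, RingEquiv.symm_apply_apply]

end Arch

/-! ### The pushforward -/

section Pushforward

variable {K : Type} [Field K] [NumberField K]
variable [MeasurableSpace (ideleGroup K)] [BorelSpace (ideleGroup K)]

attribute [local instance] secondCountableTopology_ideleGroup
attribute [local instance] Literature.MeasureTheory.Group.Units.borelSpace_of_isOpenEmbedding
  Literature.MeasureTheory.Group.hasSummableGeomSeries_of_finiteDimensional

variable (ν : Measure (ideleGroup K)) [IsFiniteMeasureOnCompacts ν] [ν.IsMulLeftInvariant]

/-- **`∫_{𝕌_K} H(a_∞) dν(a) = c ∫_{K_∞ˣ} H d^×x`.** For a left-invariant measure `ν` on `𝕀_K` finite on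
compact sets there is `c ∈ ℝ≥0` such that for every measurable `H ≥ 0` on `K_∞ˣ`
`∫_{𝕌_K} H(archUnitsOfIdele a) dν(a) = c ∫ H d(mixedUnitsHaar K)`. [cite: CasselsFrohlichANT1967, Ch. XV §4.3] -/
theorem exists_setLIntegral_unitIdeles_eq_mul_lintegral_mixedUnits :
    ∃ c : ℝ≥0, ∀ (H : (mixedSpace K)ˣ → ℝ≥0∞), Measurable H →
      ∫⁻ a in (unitIdeles K : Set (ideleGroup K)), H (archUnitsOfIdele K a) ∂ν = c * ∫⁻ x, H x ∂mixedUnitsHaar K := by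
  set U : Set (ideleGroup K) := (unitIdeles K : Set (ideleGroup K)) with hU
  have hUm : MeasurableSet U := (GaloisRepresentations.isOpen_unitIdeles (K := K)).measurableSet
  set Θ : ideleGroup K → (mixedSpace K)ˣ := fun a => archUnitsOfIdele K a with hΘ
  have hΘc : Continuous Θ := continuous_archUnitsOfIdele
  have hΘm : Measurable Θ := hΘc.measurable
  set ρ : Measure (mixedSpace K)ˣ := (ν.restrict U).map Θ with hρ
  haveI : BorelSpace (mixedSpace K)ˣ := Literature.MeasureTheory.Group.Units.borelSpace_of_isOpenEmbedding
  haveI : MeasurableMul (mixedSpace K)ˣ := ContinuousMul.measurableMul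
  -- translation invariance
  haveI : ρ.IsMulLeftInvariant := by
    refine ⟨fun x => ?_⟩
    set t : ideleGroup K := infiniteIdeleOfMixed x with ht
    have htU : t ∈ U := infiniteIdeleOfMixed_mem_unitIdeles x
    have hΘt : ∀ a, Θ (t * a) = x * Θ a := by
      intro a
      show archUnitsOfIdele K (t * a) = x * archUnitsOfIdele K a
      rw [map_mul, ht, archUnitsOfIdele_infiniteIdeleOfMixed]
    have hcomp : ((fun z => x * z) ∘ Θ) = Θ ∘ fun a => t * a := by
      funext a; simp only [Function.comp_apply, hΘt]
    have hpre : (fun a => t * a) ⁻¹' U = U := by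
      ext a
      simp only [Set.mem_preimage, hU, SetLike.mem_coe]
      exact ⟨fun h => by simpa using (unitIdeles K).mul_mem ((unitIdeles K).inv_mem htU) h, fun h => (unitIdeles K).mul_mem htU h⟩
    rw [hρ, Measure.map_map (measurable_const_mul x) hΘm, hcomp, ← Measure.map_map hΘm (measurable_const_mul t)]
    congr 1
    conv_lhs => rw [← hpre]
    rw [← Measure.restrict_map (measurable_const_mul t) hUm, map_mul_left_eq_self]
  -- finite on compacts
  haveI : IsFiniteMeasureOnCompacts ρ := by
    refine ⟨fun C hC => ?_⟩
    -- bounds for the archimedean sizes and their inverses on `C`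
    have hcont : ∀ w : InfinitePlace K, Continuous fun z : (mixedSpace K)ˣ =>
        ‖(InfiniteAdeleRing.ringEquiv_mixedSpace K).symm (z : mixedSpace K) w‖ := fun w =>
      (continuous_apply w |>.comp ((continuous_ringEquiv_mixedSpace_symm K).comp Units.continuous_val)).norm
    have hcont' : ∀ w : InfinitePlace K, Continuous fun z : (mixedSpace K)ˣ =>
        ‖(InfiniteAdeleRing.ringEquiv_mixedSpace K).symm ((z⁻¹ : (mixedSpace K)ˣ) : mixedSpace K) w‖ := fun w =>
      (hcont w).comp continuous_inv
    obtain ⟨R, hR⟩ : ∃ R : ℝ, ∀ z ∈ C, ∀ w, ‖(InfiniteAdeleRing.ringEquiv_mixedSpace K).symm (z : mixedSpace K) w‖ ≤ R ∧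
        ‖(InfiniteAdeleRing.ringEquiv_mixedSpace K).symm ((z⁻¹ : (mixedSpace K)ˣ) : mixedSpace K) w‖ ≤ R := by
      have hf : Continuous fun z : (mixedSpace K)ˣ => ∑ w : InfinitePlace K,
          (‖(InfiniteAdeleRing.ringEquiv_mixedSpace K).symm (z : mixedSpace K) w‖ +
            ‖(InfiniteAdeleRing.ringEquiv_mixedSpace K).symm ((z⁻¹ : (mixedSpace K)ˣ) : mixedSpace K) w‖) :=
        continuous_finsetSum _ fun w _ => (hcont w).add (hcont' w)
      obtain ⟨R, hR⟩ := hC.exists_bound_of_continuousOn hf.continuousOn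
      refine ⟨R, fun z hz w => ?_⟩
      have h := hR z hz
      rw [Real.norm_eq_abs, abs_of_nonneg (Finset.sum_nonneg fun w _ => add_nonneg (norm_nonneg _) (norm_nonneg _))] at h
      have hw := Finset.single_le_sum (f := fun w : InfinitePlace K =>
          ‖(InfiniteAdeleRing.ringEquiv_mixedSpace K).symm (z : mixedSpace K) w‖ +
            ‖(InfiniteAdeleRing.ringEquiv_mixedSpace K).symm ((z⁻¹ : (mixedSpace K)ˣ) : mixedSpace K) w‖)
        (fun w _ => add_nonneg (norm_nonneg _) (norm_nonneg _)) (Finset.mem_univ w)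
      have hw' := hw.trans h
      exact ⟨le_of_add_le_of_nonneg_left hw' (norm_nonneg _), le_of_add_le_of_nonneg_right hw' (norm_nonneg _)⟩
    rw [hρ, Measure.map_apply hΘm hC.measurableSet, Measure.restrict_apply (hΘm hC.measurableSet)]
    set S : Set (ideleGroup K) := {x : ideleGroup K | x ∈ unitIdeles K ∧
      ∀ w : InfinitePlace K, ‖((x : ideleGroup K) : AdeleRing (𝓞 K) K).1 w‖ ≤ R ∧
        ‖((x⁻¹ : ideleGroup K) : AdeleRing (𝓞 K) K).1 w‖ ≤ R} with hS
    have hSc : IsCompact S := isCompact_setOf_mem_unitIdeles_norm_le R R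
    have hsub : Θ ⁻¹' C ∩ U ⊆ S := by
      rintro a ⟨haC, haU⟩
      refine ⟨haU, fun w => ?_⟩
      obtain ⟨h1, h2⟩ := hR (Θ a) haC w
      constructor
      · rw [norm_fst_eq_of_archUnitsOfIdele]; exact h1
      · rw [norm_fst_eq_of_archUnitsOfIdele, map_inv]; exact h2
    exact (measure_mono hsub).trans_lt hSc.measure_lt_top
  -- uniqueness of Haar measure on `K_∞ˣ`
  refine ⟨haarScalarFactor ρ (mixedUnitsHaar K), fun H hH => ?_⟩
  have hρeq : ρ = haarScalarFactor ρ (mixedUnitsHaar K) • mixedUnitsHaar K := isMulLeftInvariant_eq_smul ρ (mixedUnitsHaar K)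
  calc ∫⁻ a in U, H (Θ a) ∂ν = ∫⁻ x, H x ∂ρ := by rw [hρ, lintegral_map hH hΘm]
    _ = haarScalarFactor ρ (mixedUnitsHaar K) * ∫⁻ x, H x ∂mixedUnitsHaar K := by
        conv_lhs => rw [hρeq]
        rw [lintegral_smul_measure, ENNReal.smul_def, smul_eq_mul]

end Pushforward

end Literature.NumberTheory.Automorphic
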